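import Literature.Analysis.FunctionSpaces.PoissonFiniteIntensitySeries
import HarnessLib

/-!
# Two independent Poisson processes as one fairly two-coloured Poisson process (series form)

Topic `Literature/Analysis/FunctionSpaces`; PROOFS ONLY (no definitions, no named facts), on the tree's
`Literature.Analysis.FunctionSpaces.IsPoissonPointProcess ν P` (Kingman's axioms for a law `P` on locally finite
simple configurations `PointConfig E`), next to `PoissonFiniteIntensitySeries`.

**The fact.** Let `P` be a Poisson process with FINITE intensity `ν` on a second countable Hausdorff Borel space
`E`, `M = ν(E)`.  For every measurable `F ≥ 0` on PAIRS of configurations,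

  `∫ F d(P ⊗ P) = Σ_m e^{-2M}/m! ∫_{E^m} Σ_{κ : [m] → {black, white}} F({x_i : κ i = black}, {x_i : κ i = white}) ν^{⊗m}(dx)`

(`IsPoissonPointProcess.lintegral_prod_eq_tsum_twoColour`).  This is the kernel-free ("series") form of three
facts of Last–Penrose, *Lectures on the Poisson Process* (2017): the superposition of two independent Poisson
processes of intensity `ν` is a Poisson process of intensity `2ν` (Thm 3.3), a Poisson process of finite
intensity is a mixed binomial process (Prop. 3.8: `m ∼ Po(2M)` points iid `ν/M`), and conditionally on the
superposition the colours "came from the first / from the second process" are independent fair coins — the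
marking theorem (Thm 5.6) for the mark space `{black, white}` with the fair kernel, read backwards.  Indeed
`Po(2M; m) · (2ν/2M)^{⊗m} · 2^{-m} Σ_κ = e^{-2M}/m! · ν^{⊗m} Σ_κ`.  It is the form in which Benjamini–Schramm
(*Comm. Math. Phys.* 197 (1998), §9, (9.7)) "condition on the uncoloured nuclei" of a Poisson–Voronoi percolation.

**The proof** is elementary given the one-colour series PROVED in the tree
(`IsPoissonPointProcess.lintegral_eq_tsum_lintegral_ofFn`, Last–Penrose Prop. 3.8):
* Tonelli and the one-colour series in each variable give the double Poisson mixture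
  `∫ F d(P ⊗ P) = Σ_j Σ_k e^{-M}/j! e^{-M}/k! ∫∫ F({y}, {z}) ν^{⊗j}(dy) ν^{⊗k}(dz)` (`lintegral_prod_eq_tsum_tsum`);
* for a colouring `κ` of `[m]` with `j` blacks, splitting `x ∼ ν^{⊗m}` into its colour classes is the
  measure-preserving `MeasureTheory.measurePreserving_piEquivPiSubtypeProd`, and configurations do not see the
  re-indexing `{i : κ i = black} ≃ [j]` (`lintegral_pi_twoColour_eq`);
* there are `m.choose j` colourings with `j` blacks (`sum_boolColouring_eq_sum_range_choose`),
  `e^{-2M} (m choose j)/m! = e^{-M}/j! · e^{-M}/(m-j)!`, and a double series over `ℕ × ℕ` is a series over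
  antidiagonals (`tsum_sum_antidiagonal_eq_tsum_tsum`, unconditional in `ℝ≥0∞`).

## References

* G. Last, M. Penrose, *Lectures on the Poisson Process*, Cambridge Univ. Press (2017): Thm 3.3 (superposition
  theorem), Prop. 3.8 (mixed binomial representation of a Poisson process with finite intensity), Thm 5.6
  (marking theorem). [LastPenrose2017]
* I. Benjamini, O. Schramm, Conformal invariance of Voronoi percolation, *Comm. Math. Phys.* 197 (1998), §9.
-/

noncomputable section

open MeasureTheory ProbabilityTheory Set Filter Function
open scoped ENNReal

namespace Literature.Analysis.FunctionSpaces

/-! ## Configurations of finitely indexed families: re-indexing and measurability -/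

namespace PointConfig

variable {E : Type*} [TopologicalSpace E]

/-- Re-indexing a finite family of points along an equivalence does not change the configuration `{x_i}` it
spans (same range). [folklore] -/
theorem ofFn_comp_equiv {ι ι' : Type*} [Finite ι] [Finite ι'] (e : ι' ≃ ι) (x : ι → E) :
    PointConfig.ofFn (x ∘ e) = PointConfig.ofFn x := by
  refine PointConfig.ext fun y => ?_
  simp only [mem_ofFn, Function.comp_apply]
  exact ⟨fun ⟨i, hi⟩ => ⟨e i, hi⟩, fun ⟨i, hi⟩ => ⟨e.symm i, by simpa using hi⟩⟩

/-- Transporting a tuple along `MeasurableEquiv.piCongrLeft` (re-indexing the coordinates) does not change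
its configuration. [folklore] -/
theorem ofFn_piCongrLeft [MeasurableSpace E] {ι ι' : Type*} [Finite ι] [Finite ι'] (e : ι' ≃ ι)
    (x : ι' → E) :
    PointConfig.ofFn (MeasurableEquiv.piCongrLeft (fun _ : ι => E) e x) = PointConfig.ofFn x := by
  refine PointConfig.ext fun y => ?_
  simp only [mem_ofFn]
  constructor
  · rintro ⟨i, hi⟩
    refine ⟨e.symm i, ?_⟩
    have h := MeasurableEquiv.piCongrLeft_apply_apply (β := fun _ => E) e x (e.symm i)
    rw [Equiv.apply_symm_apply] at h
    rw [← h, hi]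
  · rintro ⟨i, hi⟩
    exact ⟨e i, by rw [MeasurableEquiv.piCongrLeft_apply_apply (β := fun _ => E), hi]⟩

/-- The white colour class of a two-colouring `κ` of `[m]`: `{x_i : κ i = false} = {x_i : ¬ κ i = true}`
as configurations. [folklore] -/
theorem ofFn_subtype_eq_false_eq {m : ℕ} (κ : Fin m → Bool) (x : Fin m → E) :
    PointConfig.ofFn (fun i : {i : Fin m // κ i = false} => x i.1) =
      PointConfig.ofFn (fun i : {i : Fin m // ¬ κ i = true} => x i.1) := by
  refine PointConfig.ext fun y => ?_
  simp only [mem_ofFn, Subtype.exists, Bool.not_eq_true]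

/-- Superposing with the empty configuration on the left does nothing (private copy of
`PointConfig.empty_union_eq` of `StatisticalMechanics/DiluteHardSphereGasProofs.lean`, not importable in this
low-level file). [folklore] -/
private theorem empty_union'' (c : PointConfig E) : (∅ : PointConfig E) ∪ c = c := by
  refine PointConfig.ext fun y => ?_
  simp only [mem_union, or_iff_right_iff_imp]
  exact fun hy => absurd (show y ∈ (∅ : PointConfig E).carrier from hy) (by simp)

/-- **`x ↦ {x_i : i ∈ ι}` is measurable** on `ι → E` for a finite index type `ι`: for `ι = Fin m` this is the
tree's joint measurability of `(x, c) ↦ c ∪ {x₁, …, x_m}` (`PointConfig.measurable_union_ofFn`, Last–Penrose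
(4.11)) at `c = ∅`, and a general `ι` is re-indexed along `ι ≃ Fin (card ι)` (`ofFn_comp_equiv`). [folklore] -/
theorem measurable_ofFn_fintype [T2Space E] [SecondCountableTopology E] [MeasurableSpace E]
    [OpensMeasurableSpace E] (ι : Type*) [Fintype ι] :
    Measurable fun x : ι → E => PointConfig.ofFn x := by
  have hfin : ∀ m : ℕ, Measurable fun x : Fin m → E => PointConfig.ofFn x := fun m => by
    have h := (PointConfig.measurable_union_ofFn (E := E) m).comp
      (measurable_id.prodMk (measurable_const (a := (∅ : PointConfig E))))
    refine (congrArg Measurable (funext fun x => ?_)).mp h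
    simp only [Function.comp_apply, id_eq, empty_union'']
  have heq : (fun x : ι → E => PointConfig.ofFn x) =
      fun x => PointConfig.ofFn (x ∘ (Fintype.equivFin ι).symm) :=
    funext fun x => (ofFn_comp_equiv (Fintype.equivFin ι).symm x).symm
  rw [heq]
  exact (hfin _).comp (measurable_pi_lambda _ fun i => measurable_pi_apply _)

end PointConfig

namespace IsPoissonPointProcess

/-! ## Counting colourings, the Poisson weights, and re-summation along antidiagonals -/

/-- **Colourings with a prescribed number of blacks.** Summing a function of the number of `true` values
over all colourings `κ : Fin m → Bool` counts each `j ≤ m` with multiplicity `m.choose j` (colourings are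
subsets of `[m]`, `Finset.sum_powerset_apply_card`). [folklore] -/
theorem sum_boolColouring_eq_sum_range_choose {M : Type*} [AddCommMonoid M] (m : ℕ) (g : ℕ → M) :
    ∑ κ : Fin m → Bool, g (Finset.univ.filter fun i => κ i = true).card =
      ∑ j ∈ Finset.range (m + 1), (m.choose j) • g j := by
  let e : (Fin m → Bool) ≃ Finset (Fin m) :=
    { toFun := fun κ => Finset.univ.filter fun i => κ i = true
      invFun := fun t i => decide (i ∈ t)
      left_inv := fun κ => funext fun i => by simp
      right_inv := fun t => Finset.ext fun i => by simp }
  rw [Fintype.sum_equiv e (fun κ => g (Finset.univ.filter fun i => κ i = true).card) (fun t => g t.card)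
    (fun κ => rfl)]
  have h := Finset.sum_powerset_apply_card g (x := (Finset.univ : Finset (Fin m)))
  rwa [Finset.powerset_univ, Finset.card_univ, Fintype.card_fin] at h

/-- **The Poisson weights multiply**: `e^{-2M}/m! · (m choose j) = e^{-M}/j! · e^{-M}/(m-j)!` in `ℝ≥0∞`,
for `j ≤ m`. [folklore] -/
theorem ofReal_exp_neg_two_mul_div_factorial_mul_choose (M : ℝ) {m j : ℕ} (hj : j ≤ m) :
    ENNReal.ofReal (Real.exp (-(2 * M)) / (Nat.factorial m)) * (m.choose j : ℝ≥0∞) =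
      ENNReal.ofReal (Real.exp (-M) / (Nat.factorial j)) *
        ENNReal.ofReal (Real.exp (-M) / (Nat.factorial (m - j))) := by
  rw [← ENNReal.ofReal_natCast, ← ENNReal.ofReal_mul (by positivity),
    ← ENNReal.ofReal_mul (by positivity)]
  congr 1
  rw [Nat.cast_choose ℝ hj]
  have h2 : Real.exp (-(2 * M)) = Real.exp (-M) * Real.exp (-M) := by
    rw [← Real.exp_add]; ring_nf
  have hm : (Nat.factorial m : ℝ) ≠ 0 := by positivity
  have hj' : (Nat.factorial j : ℝ) ≠ 0 := by positivity
  have hmj : (Nat.factorial (m - j) : ℝ) ≠ 0 := by positivity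
  rw [h2]
  field_simp

/-- **Re-summation of a double series along antidiagonals** in `ℝ≥0∞` (unconditional convergence):
`Σ_m Σ_{j+k=m} f j k = Σ_j Σ_k f j k`. [folklore] -/
theorem tsum_sum_antidiagonal_eq_tsum_tsum (f : ℕ → ℕ → ℝ≥0∞) :
    ∑' m : ℕ, ∑ q ∈ Finset.antidiagonal m, f q.1 q.2 = ∑' j : ℕ, ∑' k : ℕ, f j k := by
  rw [← ENNReal.tsum_prod, ← (Finset.HasAntidiagonal.sigmaAntidiagonalEquivProd).tsum_eq
    (fun p : ℕ × ℕ => f p.1 p.2), ENNReal.tsum_sigma']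
  refine tsum_congr fun m => ?_
  rw [← Finset.tsum_subtype]
  rfl

/-! ## The two-colour series -/

variable {E : Type*} [TopologicalSpace E] [T2Space E] [SecondCountableTopology E] [MeasurableSpace E]
  [BorelSpace E] {ν : Measure E} {P : Measure (PointConfig E)}

omit [T2Space E] [SecondCountableTopology E] [BorelSpace E] in
/-- **Re-indexing two independent blocks.** Along bijections `Fin j ≃ ι₁`, `Fin k ≃ ι₂` the product measure
`ν^{⊗ι₁} ⊗ ν^{⊗ι₂}` is the image of `ν^{⊗j} ⊗ ν^{⊗k}` (`MeasureTheory.measurePreserving_piCongrLeft`) and the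
configurations spanned by the two blocks do not change (`PointConfig.ofFn_piCongrLeft`). [folklore] -/
theorem lintegral_prod_pi_ofFn_reindex [SigmaFinite ν] {ι₁ ι₂ : Type*} [Fintype ι₁] [Fintype ι₂]
    {j k : ℕ} (e₁ : Fin j ≃ ι₁) (e₂ : Fin k ≃ ι₂) (Φ : PointConfig E × PointConfig E → ℝ≥0∞) :
    ∫⁻ q : (ι₁ → E) × (ι₂ → E), Φ (PointConfig.ofFn q.1, PointConfig.ofFn q.2)
        ∂((Measure.pi fun _ : ι₁ => ν).prod (Measure.pi fun _ : ι₂ => ν)) =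
      ∫⁻ q : (Fin j → E) × (Fin k → E), Φ (PointConfig.ofFn q.1, PointConfig.ofFn q.2)
        ∂((Measure.pi fun _ : Fin j => ν).prod (Measure.pi fun _ : Fin k => ν)) := by
  have h₁ := measurePreserving_piCongrLeft (fun _ : ι₁ => ν) e₁
  have h₂ := measurePreserving_piCongrLeft (fun _ : ι₂ => ν) e₂
  calc ∫⁻ q : (ι₁ → E) × (ι₂ → E), Φ (PointConfig.ofFn q.1, PointConfig.ofFn q.2)
        ∂((Measure.pi fun _ : ι₁ => ν).prod (Measure.pi fun _ : ι₂ => ν))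
      = ∫⁻ q : (Fin j → E) × (Fin k → E), (fun q : (ι₁ → E) × (ι₂ → E) =>
          Φ (PointConfig.ofFn q.1, PointConfig.ofFn q.2))
          (Prod.map (MeasurableEquiv.piCongrLeft (fun _ : ι₁ => E) e₁)
            (MeasurableEquiv.piCongrLeft (fun _ : ι₂ => E) e₂) q)
        ∂((Measure.pi fun _ : Fin j => ν).prod (Measure.pi fun _ : Fin k => ν)) :=
        ((h₁.prod h₂).lintegral_comp_emb ((MeasurableEquiv.measurableEmbedding _).prodMap
          (MeasurableEquiv.measurableEmbedding _)) _).symm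
    _ = _ := by
        refine lintegral_congr fun q => ?_
        simp only [Prod.map_fst, Prod.map_snd, PointConfig.ofFn_piCongrLeft]

/-- **The colours only re-index the points.** For a colouring `κ : [m] → {black, white}` with `j` blacks,
splitting `x ∼ ν^{⊗m}` into its black and white colour classes gives two independent blocks
`ν^{⊗j} ⊗ ν^{⊗(m-j)}` (`MeasureTheory.measurePreserving_piEquivPiSubtypeProd`, re-indexed by
`lintegral_prod_pi_ofFn_reindex`), so that
`∫ F({x_i : κ i = black}, {x_i : κ i = white}) ν^{⊗m}(dx) = ∫∫ F({y}, {z}) ν^{⊗j}(dy) ν^{⊗(m-j)}(dz)`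
depends on `κ` only through `j`. [folklore] -/
theorem lintegral_pi_twoColour_eq [SigmaFinite ν] {m : ℕ} (κ : Fin m → Bool)
    {F : PointConfig E × PointConfig E → ℝ≥0∞} (hF : Measurable F) :
    ∫⁻ x : Fin m → E, F (PointConfig.ofFn (fun i : {i : Fin m // κ i = true} => x i.1),
        PointConfig.ofFn (fun i : {i : Fin m // κ i = false} => x i.1)) ∂(Measure.pi fun _ : Fin m => ν) =
      ∫⁻ y : Fin (Finset.univ.filter fun i => κ i = true).card → E,
        ∫⁻ z : Fin (m - (Finset.univ.filter fun i => κ i = true).card) → E,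
          F (PointConfig.ofFn y, PointConfig.ofFn z) ∂(Measure.pi fun _ => ν) ∂(Measure.pi fun _ => ν) := by
  set j := (Finset.univ.filter fun i => κ i = true).card with hj
  -- the sizes of the two colour classes
  have h₁ : Fintype.card {i : Fin m // κ i = true} = j := Fintype.card_subtype _
  have h₂ : Fintype.card {i : Fin m // ¬ κ i = true} = m - j := by
    rw [Fintype.card_subtype_compl, Fintype.card_fin, Fintype.card_subtype]
  -- splitting into colour classes preserves the product measure
  have hsplit := measurePreserving_piEquivPiSubtypeProd (fun _ : Fin m => ν) (fun i : Fin m => κ i = true)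
  have hΦ : Measurable fun q : (Fin j → E) × (Fin (m - j) → E) =>
      F (PointConfig.ofFn q.1, PointConfig.ofFn q.2) :=
    hF.comp (((PointConfig.measurable_ofFn_fintype _).comp measurable_fst).prodMk
      ((PointConfig.measurable_ofFn_fintype _).comp measurable_snd))
  calc ∫⁻ x : Fin m → E, F (PointConfig.ofFn (fun i : {i : Fin m // κ i = true} => x i.1),
        PointConfig.ofFn (fun i : {i : Fin m // κ i = false} => x i.1)) ∂(Measure.pi fun _ : Fin m => ν)
      = ∫⁻ x : Fin m → E, F (PointConfig.ofFn (fun i : {i : Fin m // κ i = true} => x i.1),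
          PointConfig.ofFn (fun i : {i : Fin m // ¬ κ i = true} => x i.1)) ∂(Measure.pi fun _ : Fin m => ν) :=
        lintegral_congr fun x => by rw [PointConfig.ofFn_subtype_eq_false_eq]
    _ = ∫⁻ q : ({i : Fin m // κ i = true} → E) × ({i : Fin m // ¬ κ i = true} → E),
          F (PointConfig.ofFn q.1, PointConfig.ofFn q.2)
          ∂((Measure.pi fun _ : {i : Fin m // κ i = true} => ν).prod
            (Measure.pi fun _ : {i : Fin m // ¬ κ i = true} => ν)) :=
        (MeasurePreserving.lintegral_map_equiv
          (fun q : ({i : Fin m // κ i = true} → E) × ({i : Fin m // ¬ κ i = true} → E) =>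
            F (PointConfig.ofFn q.1, PointConfig.ofFn q.2)) _ hsplit).symm
    _ = ∫⁻ q : (Fin j → E) × (Fin (m - j) → E), F (PointConfig.ofFn q.1, PointConfig.ofFn q.2)
          ∂((Measure.pi fun _ : Fin j => ν).prod (Measure.pi fun _ : Fin (m - j) => ν)) :=
        lintegral_prod_pi_ofFn_reindex (Fintype.equivFinOfCardEq h₁).symm
          (Fintype.equivFinOfCardEq h₂).symm F
    _ = _ := lintegral_prod _ hΦ.aemeasurable

/-- **`P ⊗ P` as a double Poisson mixture.** For a Poisson process with finite intensity `ν` (`M = ν E`) and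
measurable `F ≥ 0` on pairs of configurations,
`∫ F d(P ⊗ P) = Σ_j Σ_k e^{-M}/j! · e^{-M}/k! ∫∫ F({y₁,…,y_j}, {z₁,…,z_k}) ν^{⊗j}(dy) ν^{⊗k}(dz)`
(Tonelli, and Last–Penrose Prop. 3.8 — the tree's `lintegral_eq_tsum_lintegral_ofFn` — in each variable).
[cite: LastPenrose2017, Prop. 3.8] -/
theorem lintegral_prod_eq_tsum_tsum [IsFiniteMeasure ν] (h : IsPoissonPointProcess ν P)
    {F : PointConfig E × PointConfig E → ℝ≥0∞} (hF : Measurable F) :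
    ∫⁻ p, F p ∂(P.prod P) =
      ∑' j : ℕ, ∑' k : ℕ, ENNReal.ofReal (Real.exp (-(ν univ).toReal) / (Nat.factorial j)) *
        ENNReal.ofReal (Real.exp (-(ν univ).toReal) / (Nat.factorial k)) *
        ∫⁻ y : Fin j → E, ∫⁻ z : Fin k → E, F (PointConfig.ofFn y, PointConfig.ofFn z)
          ∂(Measure.pi fun _ => ν) ∂(Measure.pi fun _ => ν) := by
  haveI := h.isProbabilityMeasure
  have hGk : ∀ k : ℕ, Measurable fun c : PointConfig E =>
      ∫⁻ z : Fin k → E, F (c, PointConfig.ofFn z) ∂(Measure.pi fun _ => ν) := fun k => by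
    have hm : Measurable fun q : PointConfig E × (Fin k → E) => F (q.1, PointConfig.ofFn q.2) :=
      hF.comp (measurable_fst.prodMk ((PointConfig.measurable_ofFn_fintype (Fin k)).comp measurable_snd))
    exact hm.lintegral_prod_right'
  -- the one-colour series in the second variable, for a fixed first configuration `c`
  have hinner : ∀ c : PointConfig E, ∫⁻ d, F (c, d) ∂P =
      ∑' k : ℕ, ENNReal.ofReal (Real.exp (-(ν univ).toReal) / (Nat.factorial k)) *
        ∫⁻ z : Fin k → E, F (c, PointConfig.ofFn z) ∂(Measure.pi fun _ => ν) := fun c =>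
    h.lintegral_eq_tsum_lintegral_ofFn (hF.comp measurable_prodMk_left)
  have hcm : ∀ (k : ℕ) (r : ℝ≥0∞),
      ∫⁻ c, r * ∫⁻ z : Fin k → E, F (c, PointConfig.ofFn z) ∂(Measure.pi fun _ => ν) ∂P =
        r * ∫⁻ c, ∫⁻ z : Fin k → E, F (c, PointConfig.ofFn z) ∂(Measure.pi fun _ => ν) ∂P := fun k r =>
    lintegral_const_mul r (hGk k)
  -- the one-colour series in the first variable
  have houter : ∀ k : ℕ, ∫⁻ c, ∫⁻ z : Fin k → E, F (c, PointConfig.ofFn z) ∂(Measure.pi fun _ => ν) ∂P =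
      ∑' j : ℕ, ENNReal.ofReal (Real.exp (-(ν univ).toReal) / (Nat.factorial j)) *
        ∫⁻ y : Fin j → E, ∫⁻ z : Fin k → E, F (PointConfig.ofFn y, PointConfig.ofFn z)
          ∂(Measure.pi fun _ => ν) ∂(Measure.pi fun _ => ν) := fun k =>
    h.lintegral_eq_tsum_lintegral_ofFn (hGk k)
  rw [lintegral_prod _ hF.aemeasurable]
  simp_rw [hinner]
  rw [lintegral_tsum fun k => ((hGk k).const_mul _).aemeasurable]
  simp_rw [hcm, houter, ← ENNReal.tsum_mul_left]
  rw [ENNReal.tsum_comm]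
  exact tsum_congr fun j => tsum_congr fun k => by ring

/-- **Two independent Poisson processes = one Poisson process of double intensity with independent
fair colours** (series form).  For a Poisson process `P` with finite intensity `ν` (mass `M = ν E`)
and measurable `F ≥ 0` on pairs of configurations,
`∫ F d(P ⊗ P) = Σ_m e^{-2M}/m! ∫_{E^m} Σ_{κ : [m] → {black, white}} F({x_i : κ i = black}, {x_i : κ i = white}) ν^{⊗m}(dx)`:
conditionally on the superposition `{x₁,…,x_m}` (a Poisson process of intensity `2ν`, Last–Penrose Thm 3.3 /
Prop 3.8) the colours are independent fair coins (the marking theorem, Last–Penrose Thm 5.6, for the mark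
space `{black, white}`). [cite: LastPenrose2017, Thm 5.6] -/
theorem lintegral_prod_eq_tsum_twoColour [IsFiniteMeasure ν]
    (h : IsPoissonPointProcess ν P) {F : PointConfig E × PointConfig E → ℝ≥0∞} (hF : Measurable F) :
    ∫⁻ p, F p ∂(P.prod P) =
      ∑' m : ℕ, ENNReal.ofReal (Real.exp (-(2 * (ν Set.univ).toReal)) / (Nat.factorial m)) *
        ∫⁻ x : Fin m → E, ∑ κ : Fin m → Bool,
            F (PointConfig.ofFn (fun i : {i : Fin m // κ i = true} => x i.1),
               PointConfig.ofFn (fun i : {i : Fin m // κ i = false} => x i.1))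
          ∂(Measure.pi fun _ : Fin m => ν) := by
  rw [h.lintegral_prod_eq_tsum_tsum hF, ← tsum_sum_antidiagonal_eq_tsum_tsum]
  refine tsum_congr fun m => ?_
  have hmeas : ∀ κ : Fin m → Bool, Measurable fun x : Fin m → E =>
      F (PointConfig.ofFn (fun i : {i : Fin m // κ i = true} => x i.1),
         PointConfig.ofFn (fun i : {i : Fin m // κ i = false} => x i.1)) := fun κ =>
    hF.comp (((PointConfig.measurable_ofFn_fintype _).comp
      (measurable_pi_lambda (fun (x : Fin m → E) (i : {i : Fin m // κ i = true}) => x i.1)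
        fun i => measurable_pi_apply i.1)).prodMk
      ((PointConfig.measurable_ofFn_fintype _).comp
        (measurable_pi_lambda (fun (x : Fin m → E) (i : {i : Fin m // κ i = false}) => x i.1)
          fun i => measurable_pi_apply i.1)))
  -- level `m`: group the `2^m` colourings by their number `j` of blacks
  have hlevel : ∑ κ : Fin m → Bool, ∫⁻ x : Fin m → E,
      F (PointConfig.ofFn (fun i : {i : Fin m // κ i = true} => x i.1),
         PointConfig.ofFn (fun i : {i : Fin m // κ i = false} => x i.1)) ∂(Measure.pi fun _ : Fin m => ν) =
      ∑ j ∈ Finset.range (m + 1), (m.choose j : ℝ≥0∞) *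
        ∫⁻ y : Fin j → E, ∫⁻ z : Fin (m - j) → E, F (PointConfig.ofFn y, PointConfig.ofFn z)
          ∂(Measure.pi fun _ => ν) ∂(Measure.pi fun _ => ν) := by
    have hc := sum_boolColouring_eq_sum_range_choose m fun j =>
      ∫⁻ y : Fin j → E, ∫⁻ z : Fin (m - j) → E, F (PointConfig.ofFn y, PointConfig.ofFn z)
        ∂(Measure.pi fun _ => ν) ∂(Measure.pi fun _ => ν)
    simp only [nsmul_eq_mul] at hc
    exact (Finset.sum_congr rfl fun κ _ => lintegral_pi_twoColour_eq κ hF).trans hc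
  rw [lintegral_finsetSum _ fun κ _ => hmeas κ, hlevel, Finset.mul_sum,
    Finset.Nat.sum_antidiagonal_eq_sum_range_succ_mk]
  refine Finset.sum_congr rfl fun j hj => ?_
  dsimp only
  rw [← mul_assoc, ofReal_exp_neg_two_mul_div_factorial_mul_choose _ (Finset.mem_range_succ_iff.mp hj)]

end IsPoissonPointProcess

end Literature.Analysis.FunctionSpaces

end
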